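import Summits.RiemannHypothesis.RiemannHypothesis.Theorems.HandoffEdge
import Literature.NumberTheory.LFunctions.WeilExplicitProofs
import Literature.NumberTheory.LFunctions.WeilExplicitArchTermProofs
import Literature.NumberTheory.LFunctions.WeilLineZerosDensity
import HarnessLib

/-!
# HANDOFF, edge block: the CROSS-TERM bound discharged (rh-explicit, track «HANDOFF», seat prove-2, ATTEMPT-4 §2 (b)–(d))

HONEST FRAMING. Nothing here bears on RH. This file and its continuation `HandoffCrossArch.lean` PROVE the cross-term bound
`HandoffCrossBound q q′ η X` of `HandoffEdge.lean` with the explicit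
`X(b) = (e^b + e^{−c′} + 4·M(c′))·(b − c′) + 2·Σ_{n ∈ [⌈e^{2c′}⌉, ⌊e^{2b}⌋]} Λ(n)/√n`, `c′ = (log q)/2 − η`,
`M(c′) = 1/(e^{c′}(1 − e^{−4c′}))`: for lobes `f ⊆ [c′, b]`, `g ⊆ [−b, −c′]` the cross kernels `f ⋆ g̃`, `g ⋆ f̃` live at lags
`|x| ∈ [2c′, 2b]` (the prime-free gap and beyond), where (b) the polar term costs `(e^b + e^{−c′})·‖f‖₁‖g‖₁`
(Mellin factorisation `weilMellin_weilConv_holds`, `weilMellin_weilReflect_holds`), (c) the primes cost the atoms in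
`[e^{2c′}, e^{2b}]` only, (d) the archimedean term costs `e^{t/2}/(2 sinh t) ≤ M(c′)` on the lag range (Bombieri's form,
`weilArchTermBombieri_eq_weilArchTerm_holds`), and `‖f‖₁² ≤ (b − c′)‖f‖₂²`. THIS file: §1 cross-kernel support/size, §2 the `L¹–L²` support inequality, §3 one-sided
Mellin bounds, §4 the polar cross bound, §5 the prime cross bound (all PROVED); (d) and the assembly are in
`HandoffCrossArch.lean`.
-/

set_option linter.dupNamespace false

noncomputable section

open Complex Filter Set MeasureTheory Literature.NumberTheory.LFunctions
open scoped Real Topology ComplexConjugate ContDiff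

namespace Summit.RiemannHypothesis.RiemannHypothesis.Theorems.Handoff

variable {f g : ℝ → ℂ}

/-! ## §1 Cross kernels: support and size -/

/-- `(f ⋆ g̃)(y) = ∫ f(u) conj g(u − y) du`. [folklore] -/
theorem weilConv_weilReflect_eq_integral (f g : ℝ → ℂ) (y : ℝ) :
    weilConv f (weilReflect g) y = ∫ u : ℝ, f u * conj (g (u - y)) := by
  rw [weilConv_apply]
  congr 1 with u
  simp [weilReflect, neg_sub]

/-- Support of a cross kernel, lower end: if `tsupport f ⊆ [c₁, d₁]`, `tsupport g ⊆ [c₂, d₂]` and `y < c₁ − d₂` then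
`(f ⋆ g̃)(y) = 0`. [folklore] -/
theorem weilConv_weilReflect_eq_zero_of_lt {c₁ d₁ c₂ d₂ y : ℝ} (hf : tsupport f ⊆ Icc c₁ d₁)
    (hg : tsupport g ⊆ Icc c₂ d₂) (hy : y < c₁ - d₂) : weilConv f (weilReflect g) y = 0 := by
  rw [weilConv_weilReflect_eq_integral]
  refine integral_eq_zero_of_ae (Eventually.of_forall fun u ↦ ?_)
  by_cases hfu : f u = 0
  · simp [hfu]
  by_cases hgu : g (u - y) = 0
  · simp [hgu]
  have hu := hf (subset_tsupport _ (Function.mem_support.2 hfu))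
  have hv := hg (subset_tsupport _ (Function.mem_support.2 hgu))
  exfalso
  linarith [hu.1, hv.2]

/-- Support of a cross kernel, upper end: if `d₁ − c₂ < y` then `(f ⋆ g̃)(y) = 0`. [folklore] -/
theorem weilConv_weilReflect_eq_zero_of_gt {c₁ d₁ c₂ d₂ y : ℝ} (hf : tsupport f ⊆ Icc c₁ d₁)
    (hg : tsupport g ⊆ Icc c₂ d₂) (hy : d₁ - c₂ < y) : weilConv f (weilReflect g) y = 0 := by
  rw [weilConv_weilReflect_eq_integral]
  refine integral_eq_zero_of_ae (Eventually.of_forall fun u ↦ ?_)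
  by_cases hfu : f u = 0
  · simp [hfu]
  by_cases hgu : g (u - y) = 0
  · simp [hgu]
  have hu := hf (subset_tsupport _ (Function.mem_support.2 hfu))
  have hv := hg (subset_tsupport _ (Function.mem_support.2 hgu))
  exfalso
  linarith [hu.2, hv.1]

/-- Size of a cross kernel: `‖(f ⋆ g̃)(y)‖ ≤ ½(‖f‖₂² + ‖g‖₂²)` for all `y` (`2|f(u)||g(u−y)| ≤ |f(u)|² + |g(u−y)|²`).
[folklore] -/
theorem norm_weilConv_weilReflect_le_half_add (hf : IsWeilTest f) (hg : IsWeilTest g) (y : ℝ) :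
    ‖weilConv f (weilReflect g) y‖ ≤ ((∫ u : ℝ, ‖f u‖ ^ 2) + ∫ u : ℝ, ‖g u‖ ^ 2) / 2 := by
  have hf2 : Integrable fun u : ℝ ↦ ‖f u‖ ^ 2 := hf.integrable_norm_sq
  have hg2 : Integrable fun u : ℝ ↦ ‖g u‖ ^ 2 := hg.integrable_norm_sq
  have hg2' : Integrable fun u : ℝ ↦ ‖g (u - y)‖ ^ 2 := hg2.comp_sub_right y
  rw [weilConv_weilReflect_eq_integral]
  calc ‖∫ u : ℝ, f u * conj (g (u - y))‖
      ≤ ∫ u : ℝ, ‖f u * conj (g (u - y))‖ := norm_integral_le_integral_norm _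
    _ ≤ ∫ u : ℝ, (‖f u‖ ^ 2 + ‖g (u - y)‖ ^ 2) / 2 := by
        refine integral_mono_of_nonneg (Eventually.of_forall fun _ ↦ norm_nonneg _)
          ((hf2.add hg2').div_const 2) (Eventually.of_forall fun u ↦ ?_)
        simp only [norm_mul, Complex.norm_conj]
        linarith [two_mul_le_add_sq ‖f u‖ ‖g (u - y)‖]
    _ = ((∫ u : ℝ, ‖f u‖ ^ 2) + ∫ u : ℝ, ‖g u‖ ^ 2) / 2 := by
        rw [integral_div, integral_add hf2 hg2', integral_sub_right_eq_self (fun u : ℝ ↦ ‖g u‖ ^ 2) y]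

/-! ## §2 `‖f‖₁² ≤ |support| · ‖f‖₂²` -/

/-- For a Weil test function supported in `[c, d]`: `(∫‖f‖)² ≤ (d − c)·∫‖f‖²` (Cauchy–Schwarz, via
`2t|f| ≤ t²·1_{[c,d]} + |f|²` for every `t` and the discriminant). [folklore] -/
theorem sq_integral_norm_le_length_mul (hf : IsWeilTest f) {c d : ℝ} (hcd : c ≤ d) (hsupp : tsupport f ⊆ Icc c d) :
    (∫ u : ℝ, ‖f u‖) ^ 2 ≤ (d - c) * ∫ u : ℝ, ‖f u‖ ^ 2 := by
  have hf1 : Integrable fun u : ℝ ↦ ‖f u‖ := (hf.1.continuous.integrable_of_hasCompactSupport hf.2).norm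
  have hf2 : Integrable fun u : ℝ ↦ ‖f u‖ ^ 2 := hf.integrable_norm_sq
  have hind : Integrable ((Icc c d).indicator fun _ : ℝ ↦ (1 : ℝ)) :=
    (continuous_const.integrableOn_Icc (a := c) (b := d)).integrable_indicator measurableSet_Icc
  have hI : ∫ u : ℝ, (Icc c d).indicator (fun _ : ℝ ↦ (1 : ℝ)) u = d - c := by
    rw [integral_indicator_const (1 : ℝ) measurableSet_Icc, Real.volume_real_Icc_of_le hcd, smul_eq_mul, mul_one]
  have hA : 0 ≤ ∫ u : ℝ, ‖f u‖ := integral_nonneg fun _ ↦ norm_nonneg _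
  have hN : 0 ≤ ∫ u : ℝ, ‖f u‖ ^ 2 := integral_nonneg fun _ ↦ by positivity
  have key : ∀ t : ℝ, 0 ≤ (∫ u : ℝ, ‖f u‖ ^ 2) + 2 * (-(∫ u : ℝ, ‖f u‖)) * t + (d - c) * t ^ 2 := by
    intro t
    rcases le_or_gt t 0 with ht | ht
    · nlinarith [mul_nonneg hA (neg_nonneg.2 ht), sq_nonneg t]
    · have hpt : ∀ u, 2 * t * ‖f u‖ ≤ t ^ 2 * (Icc c d).indicator (fun _ : ℝ ↦ (1 : ℝ)) u + ‖f u‖ ^ 2 := by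
        intro u
        by_cases hfu : f u = 0
        · rw [hfu, norm_zero]
          have : 0 ≤ (Icc c d).indicator (fun _ : ℝ ↦ (1 : ℝ)) u :=
            Set.indicator_nonneg (fun _ _ ↦ zero_le_one) u
          nlinarith [sq_nonneg t]
        · have hu : u ∈ Icc c d := hsupp (subset_tsupport _ (Function.mem_support.2 hfu))
          rw [Set.indicator_of_mem hu, mul_one]
          nlinarith [sq_nonneg (t - ‖f u‖)]
      have hint : ∫ u : ℝ, 2 * t * ‖f u‖ ≤
          ∫ u : ℝ, t ^ 2 * (Icc c d).indicator (fun _ : ℝ ↦ (1 : ℝ)) u + ‖f u‖ ^ 2 :=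
        integral_mono (hf1.const_mul _) ((hind.const_mul _).add hf2) hpt
      rw [integral_const_mul, integral_add (hind.const_mul _) hf2, integral_const_mul, hI] at hint
      linarith
  have h := sq_le_mul_of_forall_nonneg key
  rw [neg_sq] at h
  linarith [h]

/-- Product form: `‖f‖₁·‖g‖₁ ≤ (D/2)(‖f‖₂² + ‖g‖₂²)` for lobes of width `≤ D`. [folklore] -/
theorem integral_norm_mul_integral_norm_le (hf : IsWeilTest f) (hg : IsWeilTest g) {c₁ d₁ c₂ d₂ D : ℝ}
    (h1 : c₁ ≤ d₁) (h2 : c₂ ≤ d₂) (hD1 : d₁ - c₁ ≤ D) (hD2 : d₂ - c₂ ≤ D)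
    (hfs : tsupport f ⊆ Icc c₁ d₁) (hgs : tsupport g ⊆ Icc c₂ d₂) :
    (∫ u : ℝ, ‖f u‖) * ∫ u : ℝ, ‖g u‖ ≤ D / 2 * ((∫ u : ℝ, ‖f u‖ ^ 2) + ∫ u : ℝ, ‖g u‖ ^ 2) := by
  have hA := sq_integral_norm_le_length_mul hf h1 hfs
  have hB := sq_integral_norm_le_length_mul hg h2 hgs
  have ha : 0 ≤ ∫ u : ℝ, ‖f u‖ := integral_nonneg fun _ ↦ norm_nonneg _
  have hb : 0 ≤ ∫ u : ℝ, ‖g u‖ := integral_nonneg fun _ ↦ norm_nonneg _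
  have hNf : 0 ≤ ∫ u : ℝ, ‖f u‖ ^ 2 := integral_nonneg fun _ ↦ by positivity
  have hNg : 0 ≤ ∫ u : ℝ, ‖g u‖ ^ 2 := integral_nonneg fun _ ↦ by positivity
  have hD : 0 ≤ D := by linarith
  have hA' : (∫ u : ℝ, ‖f u‖) ^ 2 ≤ D * ∫ u : ℝ, ‖f u‖ ^ 2 :=
    hA.trans (mul_le_mul_of_nonneg_right hD1 hNf)
  have hB' : (∫ u : ℝ, ‖g u‖) ^ 2 ≤ D * ∫ u : ℝ, ‖g u‖ ^ 2 :=
    hB.trans (mul_le_mul_of_nonneg_right hD2 hNg)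
  have hsq : ((∫ u : ℝ, ‖f u‖) * ∫ u : ℝ, ‖g u‖) ^ 2 ≤
      (D / 2 * ((∫ u : ℝ, ‖f u‖ ^ 2) + ∫ u : ℝ, ‖g u‖ ^ 2)) ^ 2 := by
    have h3 : ((∫ u : ℝ, ‖f u‖) * ∫ u : ℝ, ‖g u‖) ^ 2 ≤ (D * ∫ u : ℝ, ‖f u‖ ^ 2) * (D * ∫ u : ℝ, ‖g u‖ ^ 2) := by
      rw [mul_pow]
      exact mul_le_mul hA' hB' (sq_nonneg _) (by positivity)
    nlinarith [sq_nonneg ((∫ u : ℝ, ‖f u‖ ^ 2) - ∫ u : ℝ, ‖g u‖ ^ 2), sq_nonneg D]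
  exact (pow_le_pow_iff_left₀ (mul_nonneg ha hb) (by positivity) two_ne_zero).1 hsq

/-! ## §3 One-sided Mellin bounds at `s = 0, 1` -/

/-- `‖cexp((s − ½)·t)‖ = e^{(Re s − ½) t}` for real `t`. [folklore] -/
theorem norm_cexp_sub_half_mul (s : ℂ) (t : ℝ) : ‖cexp ((s - 1 / 2) * t)‖ = Real.exp ((s.re - 1 / 2) * t) := by
  rw [Complex.norm_exp]
  congr 1
  simp [Complex.mul_re]

/-- `‖f̂(1)‖ ≤ e^{d/2}·∫‖f‖` for `tsupport f ⊆ [c, d]`. [folklore] -/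
theorem norm_weilMellin_one_le (hf : IsWeilTest f) {c d : ℝ} (hsupp : tsupport f ⊆ Icc c d) :
    ‖weilMellin f 1‖ ≤ Real.exp (d / 2) * ∫ u : ℝ, ‖f u‖ := by
  have hint : Integrable fun u : ℝ ↦ ‖f u‖ := (hf.1.continuous.integrable_of_hasCompactSupport hf.2).norm
  unfold weilMellin
  calc ‖∫ t : ℝ, f t * cexp ((1 - 1 / 2) * t)‖
      ≤ ∫ t : ℝ, ‖f t * cexp ((1 - 1 / 2) * t)‖ := norm_integral_le_integral_norm _
    _ ≤ ∫ t : ℝ, Real.exp (d / 2) * ‖f t‖ := by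
        refine integral_mono_of_nonneg (Eventually.of_forall fun _ ↦ norm_nonneg _) (hint.const_mul _)
          (Eventually.of_forall fun t ↦ ?_)
        simp only [norm_mul, norm_cexp_sub_half_mul, Complex.one_re]
        by_cases hft : f t = 0
        · simp [hft]
        · have ht : t ∈ Icc c d := hsupp (subset_tsupport _ (Function.mem_support.2 hft))
          have : Real.exp ((1 - 1 / 2) * t) ≤ Real.exp (d / 2) := Real.exp_le_exp.2 (by linarith [ht.2])
          calc ‖f t‖ * Real.exp ((1 - 1 / 2) * t) ≤ ‖f t‖ * Real.exp (d / 2) :=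
                mul_le_mul_of_nonneg_left this (norm_nonneg _)
            _ = Real.exp (d / 2) * ‖f t‖ := mul_comm _ _
    _ = Real.exp (d / 2) * ∫ u : ℝ, ‖f u‖ := integral_const_mul _ _

/-- `‖f̂(0)‖ ≤ e^{−c/2}·∫‖f‖` for `tsupport f ⊆ [c, d]`. [folklore] -/
theorem norm_weilMellin_zero_le (hf : IsWeilTest f) {c d : ℝ} (hsupp : tsupport f ⊆ Icc c d) :
    ‖weilMellin f 0‖ ≤ Real.exp (-c / 2) * ∫ u : ℝ, ‖f u‖ := by
  have hint : Integrable fun u : ℝ ↦ ‖f u‖ := (hf.1.continuous.integrable_of_hasCompactSupport hf.2).norm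
  unfold weilMellin
  calc ‖∫ t : ℝ, f t * cexp ((0 - 1 / 2) * t)‖
      ≤ ∫ t : ℝ, ‖f t * cexp ((0 - 1 / 2) * t)‖ := norm_integral_le_integral_norm _
    _ ≤ ∫ t : ℝ, Real.exp (-c / 2) * ‖f t‖ := by
        refine integral_mono_of_nonneg (Eventually.of_forall fun _ ↦ norm_nonneg _) (hint.const_mul _)
          (Eventually.of_forall fun t ↦ ?_)
        simp only [norm_mul, norm_cexp_sub_half_mul, Complex.zero_re]
        by_cases hft : f t = 0
        · simp [hft]
        · have ht : t ∈ Icc c d := hsupp (subset_tsupport _ (Function.mem_support.2 hft))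
          have : Real.exp ((0 - 1 / 2) * t) ≤ Real.exp (-c / 2) := Real.exp_le_exp.2 (by linarith [ht.1])
          calc ‖f t‖ * Real.exp ((0 - 1 / 2) * t) ≤ ‖f t‖ * Real.exp (-c / 2) :=
                mul_le_mul_of_nonneg_left this (norm_nonneg _)
            _ = Real.exp (-c / 2) * ‖f t‖ := mul_comm _ _
    _ = Real.exp (-c / 2) * ∫ u : ℝ, ‖f u‖ := integral_const_mul _ _

/-! ## §4 The polar cross term -/

/-- **Polar cross bound.** For lobes `f ⊆ [c′, b]`, `g ⊆ [−b, −c′]` (`0 ≤ c′`):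
`‖polar(f ⋆ g̃) + polar(g ⋆ f̃)‖ ≤ 2(e^b + e^{−c′})·‖f‖₁‖g‖₁` (Mellin factorisation; `f̂(1), ĝ(0)` cost `e^{b/2}`,
`f̂(0), ĝ(1)` cost `e^{−c′/2}`). [cite: Bombieri2000, §3 (f̃(s) = ĝ(s)(ḡ)̃(1−s))] -/
theorem norm_weilPolarTerm_cross_le (hf : IsWeilTest f) (hg : IsWeilTest g) {c' b : ℝ}
    (hfs : tsupport f ⊆ Icc c' b) (hgs : tsupport g ⊆ Icc (-b) (-c')) :
    ‖weilPolarTerm (weilConv f (weilReflect g)) + weilPolarTerm (weilConv g (weilReflect f))‖ ≤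
      2 * (Real.exp b + Real.exp (-c')) * ((∫ u : ℝ, ‖f u‖) * ∫ u : ℝ, ‖g u‖) := by
  have hM : ∀ {u v : ℝ → ℂ}, IsWeilTest u → IsWeilTest v → ∀ s : ℂ,
      weilMellin (weilConv u (weilReflect v)) s = weilMellin u s * conj (weilMellin v (1 - conj s)) := by
    intro u v hu hv s
    rw [weilMellin_weilConv_holds hu.1.continuous hu.2 hv.weilReflect.1.continuous hv.weilReflect.2,
      weilMellin_weilReflect_holds]
  have hf1 := norm_weilMellin_one_le hf hfs      -- e^{b/2}
  have hf0 := norm_weilMellin_zero_le hf hfs     -- e^{-c'/2}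
  have hg1 := norm_weilMellin_one_le hg hgs      -- e^{-c'/2}
  have hg0 := norm_weilMellin_zero_le hg hgs     -- e^{b/2}  (exp(-(-b)/2))
  set A := ∫ u : ℝ, ‖f u‖ with hA
  set B := ∫ u : ℝ, ‖g u‖ with hB
  have hA0 : 0 ≤ A := integral_nonneg fun _ ↦ norm_nonneg _
  have hB0 : 0 ≤ B := integral_nonneg fun _ ↦ norm_nonneg _
  unfold weilPolarTerm
  rw [hM hf hg 0, hM hf hg 1, hM hg hf 0, hM hg hf 1]
  simp only [map_zero, map_one, sub_zero, sub_self]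
  have e1 : Real.exp (b / 2) * Real.exp (-(-b) / 2) = Real.exp b := by
    rw [← Real.exp_add]; ring_nf
  have e2 : Real.exp (-c' / 2) * Real.exp (-c' / 2) = Real.exp (-c') := by
    rw [← Real.exp_add]; ring_nf
  -- the four products
  have t1 : ‖weilMellin f 0 * conj (weilMellin g 1)‖ ≤ Real.exp (-c') * (A * B) := by
    rw [norm_mul, Complex.norm_conj]
    calc ‖weilMellin f 0‖ * ‖weilMellin g 1‖ ≤ (Real.exp (-c' / 2) * A) * (Real.exp (-c' / 2) * B) :=
          mul_le_mul hf0 hg1 (norm_nonneg _) (by positivity)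
      _ = Real.exp (-c') * (A * B) := by rw [← e2]; ring
  have t2 : ‖weilMellin f 1 * conj (weilMellin g 0)‖ ≤ Real.exp b * (A * B) := by
    rw [norm_mul, Complex.norm_conj]
    calc ‖weilMellin f 1‖ * ‖weilMellin g 0‖ ≤ (Real.exp (b / 2) * A) * (Real.exp (-(-b) / 2) * B) :=
          mul_le_mul hf1 hg0 (norm_nonneg _) (by positivity)
      _ = Real.exp b * (A * B) := by rw [← e1]; ring
  have t3 : ‖weilMellin g 0 * conj (weilMellin f 1)‖ ≤ Real.exp b * (A * B) := by
    rw [norm_mul, Complex.norm_conj]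
    calc ‖weilMellin g 0‖ * ‖weilMellin f 1‖ ≤ (Real.exp (-(-b) / 2) * B) * (Real.exp (b / 2) * A) :=
          mul_le_mul hg0 hf1 (norm_nonneg _) (by positivity)
      _ = Real.exp b * (A * B) := by rw [← e1]; ring
  have t4 : ‖weilMellin g 1 * conj (weilMellin f 0)‖ ≤ Real.exp (-c') * (A * B) := by
    rw [norm_mul, Complex.norm_conj]
    calc ‖weilMellin g 1‖ * ‖weilMellin f 0‖ ≤ (Real.exp (-c' / 2) * B) * (Real.exp (-c' / 2) * A) :=
          mul_le_mul hg1 hf0 (norm_nonneg _) (by positivity)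
      _ = Real.exp (-c') * (A * B) := by rw [← e2]; ring
  calc ‖weilMellin f 0 * conj (weilMellin g 1) + weilMellin f 1 * conj (weilMellin g 0) +
        (weilMellin g 0 * conj (weilMellin f 1) + weilMellin g 1 * conj (weilMellin f 0))‖
      ≤ ‖weilMellin f 0 * conj (weilMellin g 1)‖ + ‖weilMellin f 1 * conj (weilMellin g 0)‖ +
        (‖weilMellin g 0 * conj (weilMellin f 1)‖ + ‖weilMellin g 1 * conj (weilMellin f 0)‖) := by
          refine (norm_add_le _ _).trans (add_le_add (norm_add_le _ _) (norm_add_le _ _))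
    _ ≤ 2 * (Real.exp b + Real.exp (-c')) * (A * B) := by linarith

/-! ## §5 The prime cross term -/

/-- The atom mass of the lag range `[2c′, 2b]`: `Σ_{⌈e^{2c′}⌉ ≤ n ≤ ⌊e^{2b}⌋} Λ(n)/√n`. [this track, ATTEMPT-4 §2 (c)] -/
def gapAtomSum (c' b : ℝ) : ℝ :=
  ∑ n ∈ Finset.Icc ⌈Real.exp (2 * c')⌉₊ ⌊Real.exp (2 * b)⌋₊, (ArithmeticFunction.vonMangoldt n : ℝ) / Real.sqrt n

/-- `gapAtomSum ≥ 0`. [folklore] -/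
theorem gapAtomSum_nonneg (c' b : ℝ) : 0 ≤ gapAtomSum c' b :=
  Finset.sum_nonneg fun _ _ ↦ div_nonneg ArithmeticFunction.vonMangoldt_nonneg (Real.sqrt_nonneg _)

/-- **Prime cross bound** for a kernel supported in `[2c′, 2b] ∪ [−2b, −2c′]` and bounded by `N` pointwise:
`‖prime(k)‖ ≤ 2·gapAtomSum(c′,b)·N`. [cite: Bombieri2000Weil, Thm 2 (prime side); this track, ATTEMPT-4 §2 (c)] -/
theorem norm_weilPrimeTerm_le_of_support {k : ℝ → ℂ} {c' b N : ℝ} (hc' : 0 < c')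
    (hzero : ∀ y : ℝ, |y| < 2 * c' → k y = 0) (hzero' : ∀ y : ℝ, 2 * b < |y| → k y = 0)
    (hbound : ∀ y : ℝ, ‖k y‖ ≤ N) :
    ‖weilPrimeTerm k‖ ≤ 2 * gapAtomSum c' b * N := by
  have hN : 0 ≤ N := (norm_nonneg _).trans (hbound 0)
  set s := Finset.Icc ⌈Real.exp (2 * c')⌉₊ ⌊Real.exp (2 * b)⌋₊ with hs
  have hvan : ∀ n ∉ s, ((ArithmeticFunction.vonMangoldt n : ℝ) : ℂ) / (Real.sqrt n : ℂ) *
      (k (Real.log n) + k (-Real.log n)) = 0 := by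
    intro n hn
    rw [hs, Finset.mem_Icc, not_and_or, not_le, not_le] at hn
    have hk : k (Real.log n) = 0 ∧ k (-Real.log n) = 0 := by
      rcases hn with hlt | hgt
      · -- n < ⌈e^{2c'}⌉ : log n < 2c'
        have hnlt : (n : ℝ) < Real.exp (2 * c') := Nat.lt_ceil.1 hlt
        have hlog : |Real.log n| < 2 * c' := by
          rcases Nat.eq_zero_or_pos n with rfl | hpos
          · simp; linarith
          · have hn0 : (0 : ℝ) < n := by exact_mod_cast hpos
            have h1 : Real.log n < 2 * c' := by rwa [Real.log_lt_iff_lt_exp hn0]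
            have h2 : -(2 * c') < Real.log n := by
              have : (1 : ℝ) ≤ n := by exact_mod_cast hpos
              linarith [Real.log_nonneg this]
            exact abs_lt.2 ⟨h2, h1⟩
        exact ⟨hzero _ hlog, hzero _ (by rwa [abs_neg])⟩
      · -- ⌊e^{2b}⌋ < n : 2b < log n
        have hngt : Real.exp (2 * b) < n := (Nat.floor_lt (Real.exp_pos _).le).1 hgt
        have hn0 : (0 : ℝ) < n := (Real.exp_pos _).trans hngt
        have hlog : 2 * b < Real.log n := by rwa [Real.lt_log_iff_exp_lt hn0]
        have habs : 2 * b < |Real.log n| := hlog.trans_le (le_abs_self _)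
        exact ⟨hzero' _ habs, hzero' _ (by rwa [abs_neg])⟩
    rw [hk.1, hk.2, add_zero, mul_zero]
  unfold weilPrimeTerm
  rw [tsum_eq_sum hvan]
  calc ‖∑ n ∈ s, ((ArithmeticFunction.vonMangoldt n : ℝ) : ℂ) / (Real.sqrt n : ℂ) * (k (Real.log n) + k (-Real.log n))‖
      ≤ ∑ n ∈ s, ‖((ArithmeticFunction.vonMangoldt n : ℝ) : ℂ) / (Real.sqrt n : ℂ) * (k (Real.log n) + k (-Real.log n))‖ :=
        norm_sum_le _ _
    _ ≤ ∑ n ∈ s, (ArithmeticFunction.vonMangoldt n : ℝ) / Real.sqrt n * (2 * N) := by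
        refine Finset.sum_le_sum fun n _ ↦ ?_
        rw [norm_mul, norm_div, Complex.norm_real, Complex.norm_real, Real.norm_eq_abs, Real.norm_eq_abs,
          abs_of_nonneg ArithmeticFunction.vonMangoldt_nonneg, abs_of_nonneg (Real.sqrt_nonneg _)]
        refine mul_le_mul_of_nonneg_left ?_ (div_nonneg ArithmeticFunction.vonMangoldt_nonneg (Real.sqrt_nonneg _))
        exact (norm_add_le _ _).trans (by linarith [hbound (Real.log n), hbound (-Real.log n)])
    _ = 2 * gapAtomSum c' b * N := by
        rw [gapAtomSum, ← hs, ← Finset.sum_mul]; ring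

end Summit.RiemannHypothesis.RiemannHypothesis.Theorems.Handoff
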